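import Summits.AtomisticToContinuum.HydrodynamicLimit.Theses.VitaliAmplitudeTransfer

/-!
# Birth skeleton (BC3) for the crux `VitaliAmplitudeTransfer.AnalyticPreShockPathsR`
# (stmt-AtomisticToContinuum-17806, route-AtomisticToContinuum-VitaliAmplitudeTransfer, rank 5)

The crux C′ (packing-guarded analytic pre-shock paths): `∃ η₀ > 0` (outermost) such that for data
bounds `B ≥ 1` there is `σ₀(B)` with, for `0 < σ < σ₀`, every classical hard-sphere Euler solution
`(ρ, u, θ)` on `[0,T)` whose packing `ρ_s(x)σ³` stays below `η₀`, with data in `[1/B, B]` and unit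
mass, and every `t < T`, admit `T' ∈ (t, T]` and a `δ ∈ [0,1]`-family of classical solutions on
`[0,T')` joining a constant state (`δ = 0`) to the input (`δ = 1`): unit mass and bounds `2B`, data
real-analytic in `(δ, x)` on `[0,1) × 𝕋³`, tested fields `δ`-analytic on `[0,1)` at every `s < T'`,
family jointly `C¹` on `[0,1] × [0,t] × 𝕋³`.

## The cut (the route's own TWO-LAYER PLAN: AnalyticDependence → PreShockConnectivity → C′)

Three registered stubs, none of which is the crux or the summit in costume:

* `stub_preShockConnectivity` (A — the OPEN geometric content, hardest; Sideris1985 /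
  Christodoulou2008 / MerleEtAl2022 are the threat): PRE-SHOCK ANALYTIC PATH-CONNECTIVITY OF THE
  DILUTE REGION IN DATA SPACE. For every band `η₁ > 0` there is an input threshold `η₀ > 0` such that
  … (the crux's frame) … for every `t < T` there are `T' ∈ (t, T)`, `a < 0` and a DATA PATH
  `(r₀, θ₀, u₀)_δ`, `δ ∈ [a, 1]`, with: endpoint `δ = 1` = the input data, constant at `δ = 0`, unit
  mass and bounds `2B` on `[0,1]`, real-analytic in `(δ, x)` on `(a,1) × 𝕋³`, `C^∞` on `[a,1] × 𝕋³`,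
  and — the content — EVERY MEMBER'S classical solution lives beyond `T'` (`∃ T'' > T'`) with packing
  `< η₁` on `[0,T']`. A statement about lifespans of individual data; no solution family, no joint
  regularity, no tested-field analyticity. (`a < 0`: the crux's `AnalyticOnNhd … (Ico 0 1 …)` clauses
  are NEIGHBOURHOOD conditions at `δ = 0`, so the path must extend analytically below `0`.)
* `stub_solutionFamily` (R — deterministic well-posedness along a smooth dilute data path; Kato1975,
  Majda1984 Ch. 2, Dafermos2005 Thm 5.1.1; size L in Lean): there is a band `η₂ > 0` such that for a
  `C^∞` data path on `[a,b] × 𝕋³` each of whose members has a classical solution beyond `T'` with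
  packing `< η₂` on `[0,T']`, there is a FAMILY `(ρE, θE, uE)` with exactly those data (for every real
  `δ`), classical on `[0,T')` for `δ ∈ [a,b]`, UNIQUE among classical solutions with the same data on
  the common window, and jointly `C¹` in `(δ, s, x)` on `[a,b] × [0,t] × 𝕋³` for every `t < T'`
  (uniqueness by the relative-energy estimate inside the band where `hsPressure` is smooth and the
  system symmetrizable; joint smoothness = smooth dependence on data with the derivative loss absorbed
  by `C^∞` data).
* `stub_analyticDependence` (B — propagation of analyticity; AlinhacMetivier1984 in the augmented
  space variables `(δ, x)` (zero characteristic speed in `δ`), plus analyticity of parameter integrals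
  over the compact torus; size M/L): there is a band `η₃ > 0` such that a family of classical
  solutions on `[0,T')`, indexed by an OPEN `δ`-interval, with packing `< η₃` and data jointly
  real-analytic in `(δ, x)`, has `δ`-analytic tested density / momentum / energy fields at every
  `s < T'`.

Assembly `AnalyticPreShockPathsR_of` (kernel-checked, no sorry): `η₁ := min η₂ η₃`, `η₀` from A; R on
`[a, 1]` builds the family; the per-member guard of A is transferred to the family by R's uniqueness;
member `1` = the input on `[0,T')` by uniqueness against the input itself (`T' < T`); B on `(a, 1)`
gives the tested analyticity, restricted to `[0,1) ⊂ (a,1)`; data analyticity / constancy / mass and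
bounds through the data identity; joint `C¹` by monotonicity `[0,1] ⊆ [a,1]`.

Disproof used: none on file for this crux (`ledger crux ls stmt-AtomisticToContinuum-17806`: no
Disproof.lean, no Negative lemmas, 2026-08-17).
-/

namespace Summit.AtomisticToContinuum.HydrodynamicLimit.Cruxes.AnalyticPreShockPathsR.Birth

/-! ## Registered stubs (`Holds.stub_*`, bodies `sorry`) -/

namespace Holds

/-- STUB A (`preShockConnectivity`, the open content; hardest). Pre-shock analytic path-connectivity
of the dilute region in DATA space: for every packing band `η₁ > 0` there is an input threshold
`η₀ > 0` such that for data bounds `B ≥ 1` and `σ < σ₀(B)`, every classical hs-Euler solution on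
`[0,T)` with packing `< η₀`, data in `[1/B, B]` and unit mass, and every `t < T`, admit `T' ∈ (t,T)`,
`a < 0` and a data path `(r₀, θ₀, u₀)_δ`, `δ ∈ [a,1]` — endpoint = the input data, constant at
`δ = 0`, unit mass and bounds `2B` on `[0,1]`, real-analytic in `(δ,x)` on `(a,1) × 𝕋³`, `C^∞` on
`[a,1] × 𝕋³` — every member of which has a classical solution beyond `T'` with packing `< η₁` on
`[0,T']`. Why it might fail: focusing (Sideris1985, Christodoulou2008, MerleEtAl2022) may push the
lifespan below `t`, or a member out of the band, along every analytic path in the `2B` box; for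
Burgers `T* = 1/max(-u₀')` makes `{T* > t}` star-shaped about constants. [cite: Sideris1985]
[cite: Majda1984] [cite: Christodoulou2008] -/
theorem stub_preShockConnectivity :
    ∀ η₁ : ℝ, 0 < η₁ → ∃ η₀ : ℝ, 0 < η₀ ∧ ∀ B : ℝ, 1 ≤ B → ∃ σ₀ : ℝ, 0 < σ₀ ∧ ∀ σ : ℝ, 0 < σ → σ < σ₀ →
    ∀ (T : ℝ) (ρ θ : ℝ → Literature.MathematicalPhysics.KineticTheory.T3 → ℝ) (u : ℝ → Literature.MathematicalPhysics.KineticTheory.T3 → Literature.MathematicalPhysics.KineticTheory.V3), Literature.MathematicalPhysics.KineticTheory.IsHardSphereEulerSolution σ T ρ u θ →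
    (∀ s ∈ Set.Ico 0 T, ∀ x, ρ s x * σ ^ 3 < η₀) →
    (∀ x, B⁻¹ ≤ ρ 0 x ∧ ρ 0 x ≤ B ∧ B⁻¹ ≤ θ 0 x ∧ θ 0 x ≤ B ∧ ‖u 0 x‖ ≤ B) →
    (∫ x, ρ 0 x = 1) →
    ∀ t ∈ Set.Ico 0 T, ∃ T' : ℝ, t < T' ∧ T' < T ∧ ∃ a : ℝ, a < 0 ∧
    ∃ (r₀ θ₀ : ℝ → Literature.MathematicalPhysics.KineticTheory.T3 → ℝ) (u₀ : ℝ → Literature.MathematicalPhysics.KineticTheory.T3 → Literature.MathematicalPhysics.KineticTheory.V3),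
    (r₀ 1 = ρ 0 ∧ u₀ 1 = u 0 ∧ θ₀ 1 = θ 0) ∧
    (∀ x y, r₀ 0 x = r₀ 0 y ∧ u₀ 0 x = u₀ 0 y ∧ θ₀ 0 x = θ₀ 0 y) ∧
    (∀ δ ∈ Set.Icc (0:ℝ) 1, (∫ x, r₀ δ x = 1) ∧ ∀ x, (2 * B)⁻¹ ≤ r₀ δ x ∧ r₀ δ x ≤ 2 * B ∧
    (2 * B)⁻¹ ≤ θ₀ δ x ∧ θ₀ δ x ≤ 2 * B ∧ ‖u₀ δ x‖ ≤ 2 * B) ∧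
    AnalyticOnNhd ℝ (Literature.Analysis.FunctionSpaces.Torus.stLift r₀) (Set.Ioo a 1 ×ˢ Set.univ) ∧
    AnalyticOnNhd ℝ (Literature.Analysis.FunctionSpaces.Torus.stLift θ₀) (Set.Ioo a 1 ×ˢ Set.univ) ∧
    AnalyticOnNhd ℝ (Literature.Analysis.FunctionSpaces.Torus.stLift u₀) (Set.Ioo a 1 ×ˢ Set.univ) ∧
    ContDiffOn ℝ ((⊤ : ℕ∞) : WithTop ℕ∞) (Literature.Analysis.FunctionSpaces.Torus.stLift r₀) (Set.Icc a 1 ×ˢ Set.univ) ∧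
    ContDiffOn ℝ ((⊤ : ℕ∞) : WithTop ℕ∞) (Literature.Analysis.FunctionSpaces.Torus.stLift θ₀) (Set.Icc a 1 ×ˢ Set.univ) ∧
    ContDiffOn ℝ ((⊤ : ℕ∞) : WithTop ℕ∞) (Literature.Analysis.FunctionSpaces.Torus.stLift u₀) (Set.Icc a 1 ×ˢ Set.univ) ∧
    (∀ δ ∈ Set.Icc a 1, ∃ T'' : ℝ, T' < T'' ∧ ∃ (ρ' θ' : ℝ → Literature.MathematicalPhysics.KineticTheory.T3 → ℝ) (u' : ℝ → Literature.MathematicalPhysics.KineticTheory.T3 → Literature.MathematicalPhysics.KineticTheory.V3),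
    Literature.MathematicalPhysics.KineticTheory.IsHardSphereEulerSolution σ T'' ρ' u' θ' ∧ ρ' 0 = r₀ δ ∧ u' 0 = u₀ δ ∧ θ' 0 = θ₀ δ ∧
    ∀ s ∈ Set.Icc 0 T', ∀ x, ρ' s x * σ ^ 3 < η₁) := by
  sorry

/-- STUB R (`solutionFamily`; Kato1975 / Majda1984 Ch. 2 / Dafermos2005 Thm 5.1.1; size L). Classical
well-posedness of the hard-sphere Euler system ALONG A SMOOTH DILUTE DATA PATH: inside a packing band
`η₂ > 0` (where `hsPressure` is real-analytic and the system symmetrizable hyperbolic with a convex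
entropy), a `C^∞` data path on `[a,b] × 𝕋³` each of whose members has a classical solution beyond
`T'` with packing `< η₂` on `[0,T']` carries a solution FAMILY with exactly those data, classical on
`[0,T')`, UNIQUE among classical solutions with the same data on the common time window (relative
energy), and jointly `C¹` in `(δ, s, x)` on `[a,b] × [0,t] × 𝕋³` for every `t < T'` (smooth
dependence on data, derivative loss absorbed by `C^∞` data). [cite: Kato1975] [cite: Majda1984]
[cite: Dafermos2005, Thm 5.1.1] -/
theorem stub_solutionFamily :
    ∃ η₂ : ℝ, 0 < η₂ ∧ ∀ σ : ℝ, 0 < σ → ∀ (a b T' : ℝ) (r₀ θ₀ : ℝ → Literature.MathematicalPhysics.KineticTheory.T3 → ℝ) (u₀ : ℝ → Literature.MathematicalPhysics.KineticTheory.T3 → Literature.MathematicalPhysics.KineticTheory.V3),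
    ContDiffOn ℝ ((⊤ : ℕ∞) : WithTop ℕ∞) (Literature.Analysis.FunctionSpaces.Torus.stLift r₀) (Set.Icc a b ×ˢ Set.univ) →
    ContDiffOn ℝ ((⊤ : ℕ∞) : WithTop ℕ∞) (Literature.Analysis.FunctionSpaces.Torus.stLift θ₀) (Set.Icc a b ×ˢ Set.univ) →
    ContDiffOn ℝ ((⊤ : ℕ∞) : WithTop ℕ∞) (Literature.Analysis.FunctionSpaces.Torus.stLift u₀) (Set.Icc a b ×ˢ Set.univ) →
    (∀ δ ∈ Set.Icc a b, ∃ T'' : ℝ, T' < T'' ∧ ∃ (ρ' θ' : ℝ → Literature.MathematicalPhysics.KineticTheory.T3 → ℝ) (u' : ℝ → Literature.MathematicalPhysics.KineticTheory.T3 → Literature.MathematicalPhysics.KineticTheory.V3),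
    Literature.MathematicalPhysics.KineticTheory.IsHardSphereEulerSolution σ T'' ρ' u' θ' ∧ ρ' 0 = r₀ δ ∧ u' 0 = u₀ δ ∧ θ' 0 = θ₀ δ ∧
    ∀ s ∈ Set.Icc 0 T', ∀ x, ρ' s x * σ ^ 3 < η₂) →
    ∃ (ρE θE : ℝ → ℝ → Literature.MathematicalPhysics.KineticTheory.T3 → ℝ) (uE : ℝ → ℝ → Literature.MathematicalPhysics.KineticTheory.T3 → Literature.MathematicalPhysics.KineticTheory.V3),
    (∀ δ, ρE δ 0 = r₀ δ ∧ uE δ 0 = u₀ δ ∧ θE δ 0 = θ₀ δ) ∧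
    (∀ δ ∈ Set.Icc a b, Literature.MathematicalPhysics.KineticTheory.IsHardSphereEulerSolution σ T' (ρE δ) (uE δ) (θE δ)) ∧
    (∀ δ ∈ Set.Icc a b, ∀ (S : ℝ) (ρ' θ' : ℝ → Literature.MathematicalPhysics.KineticTheory.T3 → ℝ) (u' : ℝ → Literature.MathematicalPhysics.KineticTheory.T3 → Literature.MathematicalPhysics.KineticTheory.V3), Literature.MathematicalPhysics.KineticTheory.IsHardSphereEulerSolution σ S ρ' u' θ' →
    ρ' 0 = r₀ δ → u' 0 = u₀ δ → θ' 0 = θ₀ δ →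
    ∀ s ∈ Set.Ico 0 (min S T'), ρE δ s = ρ' s ∧ uE δ s = u' s ∧ θE δ s = θ' s) ∧
    (∀ t ∈ Set.Ico 0 T',
    ContDiffOn ℝ 1 (fun p : ℝ × ℝ × EuclideanSpace ℝ (Fin 3) => ρE p.1 p.2.1 (Literature.Analysis.FunctionSpaces.Torus.proj p.2.2)) (Set.Icc a b ×ˢ Set.Icc 0 t ×ˢ Set.univ) ∧
    ContDiffOn ℝ 1 (fun p : ℝ × ℝ × EuclideanSpace ℝ (Fin 3) => θE p.1 p.2.1 (Literature.Analysis.FunctionSpaces.Torus.proj p.2.2)) (Set.Icc a b ×ˢ Set.Icc 0 t ×ˢ Set.univ) ∧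
    ContDiffOn ℝ 1 (fun p : ℝ × ℝ × EuclideanSpace ℝ (Fin 3) => uE p.1 p.2.1 (Literature.Analysis.FunctionSpaces.Torus.proj p.2.2)) (Set.Icc a b ×ˢ Set.Icc 0 t ×ˢ Set.univ)) := by
  sorry

/-- STUB B (`analyticDependence`; AlinhacMetivier1984 + analyticity of parameter integrals; size M/L).
Propagation of analyticity in the augmented space variables `(δ, x)`: inside a packing band `η₃ > 0`,
a family of classical hs-Euler solutions on `[0,T')` indexed by an OPEN parameter interval `(a,b)`,
with packing `< η₃` and data jointly real-analytic in `(δ, x)` on `(a,b) × 𝕋³`, has tested density,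
momentum and energy fields real-analytic in `δ` on `(a,b)` at every time `s < T'` (the solution is
jointly analytic in `(δ, x)` as long as it is classical — zero characteristic speed in `δ` — and
integrals over the compact torus against a continuous `χ` preserve analyticity in `δ`).
[cite: AlinhacMetivier1984] [cite: Kato1975] -/
theorem stub_analyticDependence :
    ∃ η₃ : ℝ, 0 < η₃ ∧ ∀ σ : ℝ, 0 < σ → ∀ (a b T' : ℝ) (ρE θE : ℝ → ℝ → Literature.MathematicalPhysics.KineticTheory.T3 → ℝ) (uE : ℝ → ℝ → Literature.MathematicalPhysics.KineticTheory.T3 → Literature.MathematicalPhysics.KineticTheory.V3),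
    (∀ δ ∈ Set.Ioo a b, Literature.MathematicalPhysics.KineticTheory.IsHardSphereEulerSolution σ T' (ρE δ) (uE δ) (θE δ)) →
    (∀ δ ∈ Set.Ioo a b, ∀ s ∈ Set.Ico 0 T', ∀ x, ρE δ s x * σ ^ 3 < η₃) →
    AnalyticOnNhd ℝ (Literature.Analysis.FunctionSpaces.Torus.stLift (fun δ => ρE δ 0)) (Set.Ioo a b ×ˢ Set.univ) →
    AnalyticOnNhd ℝ (Literature.Analysis.FunctionSpaces.Torus.stLift (fun δ => θE δ 0)) (Set.Ioo a b ×ˢ Set.univ) →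
    AnalyticOnNhd ℝ (Literature.Analysis.FunctionSpaces.Torus.stLift (fun δ => uE δ 0)) (Set.Ioo a b ×ˢ Set.univ) →
    ∀ s ∈ Set.Ico 0 T', ∀ χ : Literature.MathematicalPhysics.KineticTheory.T3 → ℝ, Continuous χ →
    AnalyticOnNhd ℝ (fun δ => ∫ x, χ x * ρE δ s x) (Set.Ioo a b) ∧
    AnalyticOnNhd ℝ (fun δ => ∫ x, (χ x * ρE δ s x) • uE δ s x) (Set.Ioo a b) ∧
    AnalyticOnNhd ℝ (fun δ => ∫ x, χ x * Literature.MathematicalPhysics.KineticTheory.totalEnergyDensity (ρE δ s x) (uE δ s x) (θE δ s x)) (Set.Ioo a b) := by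
  sorry

end Holds

/-! ## Stub statements by name (the hypotheses of `_of` are these `Prop`s) -/

/-- Statement of registered stub A (`Holds.stub_preShockConnectivity`), by name. -/
def stub_preShockConnectivity : Prop := type_of% Holds.stub_preShockConnectivity
/-- Statement of registered stub R (`Holds.stub_solutionFamily`), by name. -/
def stub_solutionFamily : Prop := type_of% Holds.stub_solutionFamily
/-- Statement of registered stub B (`Holds.stub_analyticDependence`), by name. -/
def stub_analyticDependence : Prop := type_of% Holds.stub_analyticDependence

/-! ## The assembly: the three stubs imply the crux BY NAME (no sorry) -/

/-- The three stubs imply `VitaliAmplitudeTransfer.AnalyticPreShockPathsR` (pure bookkeeping: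
`η₁ := min η₂ η₃`; family from R on `[a,1]`; guard and endpoint by uniqueness; tested analyticity
from B on `(a,1) ⊇ [0,1)`; data clauses through the data identity; `C¹` by monotonicity). -/
theorem AnalyticPreShockPathsR_of (hA : stub_preShockConnectivity) (hR : stub_solutionFamily)
    (hB : stub_analyticDependence) :
    Summit.AtomisticToContinuum.HydrodynamicLimit.Theses.VitaliAmplitudeTransfer.AnalyticPreShockPathsR := by
  replace hA := (hA : type_of% Holds.stub_preShockConnectivity)
  replace hR := (hR : type_of% Holds.stub_solutionFamily)
  replace hB := (hB : type_of% Holds.stub_analyticDependence)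
  obtain ⟨η₂, hη₂, HR⟩ := hR
  obtain ⟨η₃, hη₃, HB⟩ := hB
  obtain ⟨η₀, hη₀, HA⟩ := hA (min η₂ η₃) (lt_min hη₂ hη₃)
  refine ⟨η₀, hη₀, ?_⟩
  intro B hB1
  obtain ⟨σ₀, hσ₀, HA'⟩ := HA B hB1
  refine ⟨σ₀, hσ₀, ?_⟩
  intro σ hσ hσσ₀ T ρ θ u hsol hguard hdata hmass t ht
  obtain ⟨T', htT', hT'T, a, ha, r₀, θ₀, u₀, hend, hconst, hmb, hanr, hanθ, hanu, hsmr, hsmθ, hsmu,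
    hex⟩ := HA' σ hσ hσσ₀ T ρ θ u hsol hguard hdata hmass t ht
  -- per-member existence with the guard weakened to R's band
  have hex₂ : ∀ δ ∈ Set.Icc a 1, ∃ T'' : ℝ, T' < T'' ∧
      ∃ (ρ' θ' : ℝ → Literature.MathematicalPhysics.KineticTheory.T3 → ℝ) (u' : ℝ → Literature.MathematicalPhysics.KineticTheory.T3 → Literature.MathematicalPhysics.KineticTheory.V3),
        Literature.MathematicalPhysics.KineticTheory.IsHardSphereEulerSolution σ T'' ρ' u' θ' ∧ ρ' 0 = r₀ δ ∧ u' 0 = u₀ δ ∧ θ' 0 = θ₀ δ ∧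
        ∀ s ∈ Set.Icc 0 T', ∀ x, ρ' s x * σ ^ 3 < η₂ := by
    intro δ hδ
    obtain ⟨T'', hT'', ρ', θ', u', hs', h1, h2, h3, hg⟩ := hex δ hδ
    exact ⟨T'', hT'', ρ', θ', u', hs', h1, h2, h3,
      fun s hs x => lt_of_lt_of_le (hg s hs x) (min_le_left _ _)⟩
  obtain ⟨ρE, θE, uE, hdat, hfam, huniq, hC1⟩ := HR σ hσ a 1 T' r₀ θ₀ u₀ hsmr hsmθ hsmu hex₂
  -- the family inherits the guard of the per-member solutions, by uniqueness
  have hfg : ∀ δ ∈ Set.Icc a 1, ∀ s ∈ Set.Ico 0 T', ∀ x, ρE δ s x * σ ^ 3 < min η₂ η₃ := by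
    intro δ hδ s hs x
    obtain ⟨T'', hT'', ρ', θ', u', hs', h1, h2, h3, hg⟩ := hex δ hδ
    have hu := huniq δ hδ T'' ρ' θ' u' hs' h1 h2 h3 s ⟨hs.1, lt_min (hs.2.trans hT'') hs.2⟩
    rw [hu.1]
    exact hg s ⟨hs.1, hs.2.le⟩ x
  have hIcc01 : Set.Icc (0:ℝ) 1 ⊆ Set.Icc a 1 := Set.Icc_subset_Icc ha.le le_rfl
  have hIoo : Set.Ioo a 1 ⊆ Set.Icc a 1 := Set.Ioo_subset_Icc_self
  have hIco01 : Set.Ico (0:ℝ) 1 ⊆ Set.Ioo a 1 := fun δ hδ => ⟨ha.trans_le hδ.1, hδ.2⟩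
  have hdr : (fun δ => ρE δ 0) = r₀ := funext fun δ => (hdat δ).1
  have hdu : (fun δ => uE δ 0) = u₀ := funext fun δ => (hdat δ).2.1
  have hdθ : (fun δ => θE δ 0) = θ₀ := funext fun δ => (hdat δ).2.2
  refine ⟨T', htT', hT'T.le, ρE, θE, uE, ?_, ?_, ?_, ?_, ?_, ?_, ?_, ?_, ?_, ?_, ?_⟩
  · exact fun δ hδ => hfam δ (hIcc01 hδ)
  · -- member 1 = the input on [0,T'): uniqueness against the input itself
    intro s hs
    have h1 : (1:ℝ) ∈ Set.Icc a 1 := ⟨ha.le.trans zero_le_one, le_rfl⟩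
    exact huniq 1 h1 T ρ θ u hsol hend.1.symm hend.2.1.symm hend.2.2.symm s
      ⟨hs.1, lt_min (hs.2.trans hT'T) hs.2⟩
  · intro x y
    have h := hdat 0
    rw [h.1, h.2.1, h.2.2]
    exact hconst x y
  · intro δ hδ
    have h := hdat δ
    rw [h.1, h.2.1, h.2.2]
    exact hmb δ hδ
  · rw [hdr]; exact hanr.mono (Set.prod_mono hIco01 subset_rfl)
  · rw [hdθ]; exact hanθ.mono (Set.prod_mono hIco01 subset_rfl)
  · rw [hdu]; exact hanu.mono (Set.prod_mono hIco01 subset_rfl)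
  · intro s hs χ hχ
    have hB' := HB σ hσ a 1 T' ρE θE uE (fun δ hδ => hfam δ (hIoo hδ))
      (fun δ hδ s' hs' x => lt_of_lt_of_le (hfg δ (hIoo hδ) s' hs' x) (min_le_right _ _))
      (by rw [hdr]; exact hanr) (by rw [hdθ]; exact hanθ) (by rw [hdu]; exact hanu) s hs χ hχ
    exact ⟨hB'.1.mono hIco01, hB'.2.1.mono hIco01, hB'.2.2.mono hIco01⟩
  · exact (hC1 t ⟨ht.1, htT'⟩).1.mono (Set.prod_mono hIcc01 subset_rfl)
  · exact (hC1 t ⟨ht.1, htT'⟩).2.1.mono (Set.prod_mono hIcc01 subset_rfl)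
  · exact (hC1 t ⟨ht.1, htT'⟩).2.2.mono (Set.prod_mono hIcc01 subset_rfl)

/-- D-0027 §3.3 shape: the crux from the registered stubs — an `example`, so that
`AnalyticPreShockPathsR_of` stays the unique theorem concluding the crux; it becomes the proof of the item
once the three `sorry`s are discharged. -/
example : Summit.AtomisticToContinuum.HydrodynamicLimit.Theses.VitaliAmplitudeTransfer.AnalyticPreShockPathsR :=
  AnalyticPreShockPathsR_of Holds.stub_preShockConnectivity Holds.stub_solutionFamily
    Holds.stub_analyticDependence

end Summit.AtomisticToContinuum.HydrodynamicLimit.Cruxes.AnalyticPreShockPathsR.Birth
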